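import Summits.Ventures.Crystal3D.Theorems.StickyWulffConstantPolycrystalWulffBoundBodyChange
import Summits.Ventures.Crystal3D.Theorems.StickyWulffConstantPolycrystalWulffBoundRungTwinFreeTwoClasses

/-!
# `PolycrystalWulffBound`, line `PolyDensity`: the RECOLOURING MOVE (induction step of CJ-P)

Route `StickyWulffConstant` of the venture `Summits/Ventures/Crystal3D`, crux `PolycrystalWulffBound`
(item `stmt-Ventures-19482`), second prover lane (poly-p2, gen 4).  The middle-band programme proves the
polycrystal Wulff bound for twin-free polyhedral textures by induction on the number of lattice classes
(HOME/poly-p2/MIDDLE-BAND.md, MIDDLE-BAND-g4.md; conjecture CJ-P of ROUTE §82).  Its first inductive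
move is RECOLOURING: give every grain of a union `S` of lattice classes the frame of a fixed grain `ℓ₀`
and drop the wall charges inside the merged group `S' = S ∪ class(ℓ₀)`.  This file proves, in the
crux's `let` vocabulary (`recolour_move`):

* the recoloured data `(G, A', c', m)` is again an admissible TWIN-FREE texture (`Tex`, `TF`), with
  frames `A' f = A ℓ₀` on `S` and `A f` off `S` (so its lattice classes are the old ones minus `S`);
* `En(G, A', c', m) + A_int − (√5 − √3)·Y_S ≤ En(G, A, c, m)`, where `Y_S` is the free Euclidean area
  of the grains of `S` and `A_int` the Euclidean area of the walls between grains of `S'` lying in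
  DIFFERENT old classes (those walls are charged `≥ 1` before and `0` after the move).

The free-energy half is `freeEnergy_bodyChange_ge` (`B̄(0,√3) ⊆ W ⊆ B̄(0,√5)`); the wall half is
termwise.  Combined with a rung for fewer classes applied to `(G, A', c', m)` this is the LP line
«recolour S → ℓ: En ≥ κ′·Vol^{2/3} − (√5−√3)·Y_S + A_int(S ∪ {ℓ})».
WHAT THIS IS NOT: the deletion move; a rung; F-C1 not moved.
-/

noncomputable section

open scoped BigOperators InnerProductSpace ENNReal
open MeasureTheory Filter

namespace Summit.Ventures.Crystal3D.Cruxes.PolycrystalWulffBound.PolyDensity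

open Summit.Ventures.Crystal3D.Theorems
open Summit.Ventures.Crystal3D.Cruxes.TextureLiminf.TexShadow (per polytope E3)
open Literature.MathematicalPhysics.StatisticalMechanics (perimeter)

/-- **Recolouring move.**  See the module docstring.  `cls` is any labelling of the grains with
`cls f = cls g ↔ A f '' Λ = A g '' Λ` (the lattice classes), `S` a union of classes, `ℓ₀ ∉ S`. -/
theorem recolour_move :
    let Λ : Set (EuclideanSpace ℝ (Fin 3)) := Literature.MathematicalPhysics.StatisticalMechanics.fccStacking 1 (Real.sqrt (2 / 3));
    let Brl : (ℤ → ℤ) → Set (EuclideanSpace ℝ (Fin 3)) := Literature.MathematicalPhysics.StatisticalMechanics.barlowStacking 1 (Real.sqrt (2 / 3));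
    let Ax : EuclideanSpace ℝ (Fin 3) → (EuclideanSpace ℝ (Fin 3) ≃ₗᵢ[ℝ] EuclideanSpace ℝ (Fin 3)) → (EuclideanSpace ℝ (Fin 3) ≃ₗᵢ[ℝ] EuclideanSpace ℝ (Fin 3)) → Prop := fun m A B => ∃ (L : EuclideanSpace ℝ (Fin 3) ≃ₗᵢ[ℝ] EuclideanSpace ℝ (Fin 3)) (s₁ s₂ : EuclideanSpace ℝ (Fin 3)) (σ σ' : ℤ → ℤ), Literature.MathematicalPhysics.StatisticalMechanics.IsHaggSeq σ ∧ Literature.MathematicalPhysics.StatisticalMechanics.IsHaggSeq σ' ∧ L (EuclideanSpace.single (2 : Fin 3) (1 : ℝ)) = m ∧ A '' Λ ⊆ (fun q => L q + s₁) '' Brl σ ∧ B '' Λ ⊆ (fun q => L q + s₂) '' Brl σ';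
    let CoAx : (EuclideanSpace ℝ (Fin 3) ≃ₗᵢ[ℝ] EuclideanSpace ℝ (Fin 3)) → (EuclideanSpace ℝ (Fin 3) ≃ₗᵢ[ℝ] EuclideanSpace ℝ (Fin 3)) → Prop := fun A B => ∃ m, Ax m A B;
    let Φ : EuclideanSpace ℝ (Fin 3) → ℝ := fun ν => Real.sqrt 2 / 4 * ∑ᶠ w ∈ {w ∈ Λ | ‖w‖ = 1}, |⟪w, ν⟫_ℝ|;
    let Per : Set (EuclideanSpace ℝ (Fin 3)) → Set (EuclideanSpace ℝ (Fin 3)) → ℝ := fun K S => (⨆ (ξ : EuclideanSpace ℝ (Fin 3) → EuclideanSpace ℝ (Fin 3)) (_ : ContDiff ℝ 1 ξ ∧ HasCompactSupport ξ ∧ ∀ z, ξ z ∈ K), ENNReal.ofReal (∫ z in S, Literature.MathematicalPhysics.StatisticalMechanics.fieldDivergence ξ z)).toReal;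
    let ι : Set (EuclideanSpace ℝ (Fin 3)) → Set (EuclideanSpace ℝ (Fin 3)) → Set (EuclideanSpace ℝ (Fin 3)) → ℝ := fun K S₁ S₂ => (Per K S₁ + Per K S₂ - Per K (S₁ ∪ S₂)) / 2;
    let W : (EuclideanSpace ℝ (Fin 3) ≃ₗᵢ[ℝ] EuclideanSpace ℝ (Fin 3)) → Set (EuclideanSpace ℝ (Fin 3)) := fun A => {y | ∀ ν : EuclideanSpace ℝ (Fin 3), ⟪y, ν⟫_ℝ ≤ Φ (A.symm ν)};
    let Dsc : EuclideanSpace ℝ (Fin 3) → Set (EuclideanSpace ℝ (Fin 3)) := fun m => {y | ‖y‖ ≤ 1 ∧ ⟪y, m⟫_ℝ = 0};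
    let Tex : (n : ℕ) → (Fin n → Set (EuclideanSpace ℝ (Fin 3))) → (Fin n → (EuclideanSpace ℝ (Fin 3) ≃ₗᵢ[ℝ] EuclideanSpace ℝ (Fin 3))) → (Fin n → Fin n → ℝ) → (Fin n → Fin n → EuclideanSpace ℝ (Fin 3)) → Prop := fun n G A c m => (∀ f : Fin n, Literature.MathematicalPhysics.StatisticalMechanics.HasFinitePerimeter (G f) ∧ volume (G f) < ⊤) ∧ (∀ f g, f ≠ g → Disjoint (G f) (G g)) ∧ (∀ f g, f ≠ g → 0 ≤ c f g) ∧ (∀ f g, f ≠ g → ¬ CoAx (A f) (A g) → m f g = 0 ∧ 1 ≤ c f g) ∧ (∀ f g, f ≠ g → CoAx (A f) (A g) → A f '' Λ ≠ A g '' Λ → Ax (m f g) (A f) (A g) ∧ 1 / 2 ≤ c f g);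
    let En : (n : ℕ) → (Fin n → Set (EuclideanSpace ℝ (Fin 3))) → (Fin n → (EuclideanSpace ℝ (Fin 3) ≃ₗᵢ[ℝ] EuclideanSpace ℝ (Fin 3))) → (Fin n → Fin n → ℝ) → (Fin n → Fin n → EuclideanSpace ℝ (Fin 3)) → ℝ := fun n G A c m => ∑ f : Fin n, Per (W (A f)) (G f) - ∑ f, ∑ g, (if f = g then 0 else ι (W (A f)) (G f) (G g)) + ∑ f, ∑ g, (if f = g then 0 else c f g / 2 * ι (Dsc (m f g)) (G f) (G g));
    let Poly : Set (EuclideanSpace ℝ (Fin 3)) → Prop := fun S => ∃ (k : ℕ) (H : Fin k → Finset ((EuclideanSpace ℝ (Fin 3)) × ℝ)), S = ⋃ i, ⋂ p ∈ H i, {x | ⟪p.1, x⟫_ℝ < p.2};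
    let TF : (n : ℕ) → (Fin n → (EuclideanSpace ℝ (Fin 3) ≃ₗᵢ[ℝ] EuclideanSpace ℝ (Fin 3))) → Prop := fun n A => ∀ f g : Fin n, f ≠ g → CoAx (A f) (A g) → A f '' Λ = A g '' Λ;
    ∀ (n : ℕ) (G : Fin n → Set (EuclideanSpace ℝ (Fin 3))) (A : Fin n → (EuclideanSpace ℝ (Fin 3) ≃ₗᵢ[ℝ] EuclideanSpace ℝ (Fin 3))) (c : Fin n → Fin n → ℝ) (m : Fin n → Fin n → EuclideanSpace ℝ (Fin 3))
      (β : Type) [DecidableEq β] (cls : Fin n → β) (S : Finset (Fin n)) (ℓ₀ : Fin n),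
      Tex n G A c m → (∀ f, Poly (G f)) → TF n A →
      (∀ f g : Fin n, cls f = cls g ↔ A f '' Λ = A g '' Λ) → (∀ f g : Fin n, cls f = cls g → f ∈ S → g ∈ S) → ℓ₀ ∉ S →
      let A' : Fin n → (EuclideanSpace ℝ (Fin 3) ≃ₗᵢ[ℝ] EuclideanSpace ℝ (Fin 3)) := fun f => if f ∈ S then A ℓ₀ else A f;
      let c' : Fin n → Fin n → ℝ := fun f g => if (f ∈ S ∨ cls f = cls ℓ₀) ∧ (g ∈ S ∨ cls g = cls ℓ₀) then 0 else c f g;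
      Tex n G A' c' m ∧ TF n A' ∧
      En n G A' c' m
        + (∑ f, ∑ g, (if f ≠ g ∧ (f ∈ S ∨ cls f = cls ℓ₀) ∧ (g ∈ S ∨ cls g = cls ℓ₀) ∧ cls f ≠ cls g
            then ι (Metric.closedBall (0 : EuclideanSpace ℝ (Fin 3)) 1) (G f) (G g) / 2 else 0))
        - (Real.sqrt 5 - Real.sqrt 3) * (∑ f ∈ S, (Per (Metric.closedBall (0 : EuclideanSpace ℝ (Fin 3)) 1) (G f)
            - ∑ g, (if f = g then 0 else ι (Metric.closedBall (0 : EuclideanSpace ℝ (Fin 3)) 1) (G f) (G g))))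
        ≤ En n G A c m := by
  intro Λ Brl Ax CoAx Φ Per ι W Dsc Tex En Poly TF n G A c m β _ cls S ℓ₀ hTex hPoly hTF hcls hS hℓ₀ A' c'
  classical
  obtain ⟨hfin, hdisj, hc0, hgen, hco⟩ := hTex
  have hvol : ∀ f, volume (G f) < ⊤ := fun f => (hfin f).2
  -- co-axiality of frames with the same lattice (in particular reflexivity)
  have hcoax : ∀ B B' : EuclideanSpace ℝ (Fin 3) ≃ₗᵢ[ℝ] EuclideanSpace ℝ (Fin 3),
      B '' Λ = B' '' Λ → CoAx B B' := by
    intro B B' hBB'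
    refine ⟨B (EuclideanSpace.single (2 : Fin 3) (1 : ℝ)), B, 0, 0,
      Literature.MathematicalPhysics.StatisticalMechanics.constHagg,
      Literature.MathematicalPhysics.StatisticalMechanics.constHagg,
      Literature.MathematicalPhysics.StatisticalMechanics.isHaggSeq_const,
      Literature.MathematicalPhysics.StatisticalMechanics.isHaggSeq_const, rfl, ?_, ?_⟩
    · show B '' Λ ⊆ (fun q => B q + 0) '' Λ
      simp
    · show B' '' Λ ⊆ (fun q => B q + 0) '' Λ
      rw [← hBB']; simp
  -- different classes carry generic walls
  have hwall : ∀ f g, cls f ≠ cls g → m f g = 0 ∧ 1 ≤ c f g := by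
    intro f g hne
    have hne' : A f '' Λ ≠ A g '' Λ := fun h => hne ((hcls f g).2 h)
    have hfg : f ≠ g := fun h => hne (h ▸ rfl)
    exact hgen f g hfg (fun hcx => hne' (hTF f g hfg hcx))
  -- the frame map
  set π : Fin n → Fin n := fun f => if f ∈ S then ℓ₀ else f with hπ
  have hA' : ∀ f, A' f = A (π f) := by
    intro f; by_cases h : f ∈ S <;> simp [A', hπ, h]
  -- new lattices: equal iff (both in S') or (same old class)
  have hlat' : ∀ f g, A' f '' Λ = A' g '' Λ ↔
      ((f ∈ S ∨ cls f = cls ℓ₀) ∧ (g ∈ S ∨ cls g = cls ℓ₀)) ∨ (f ∉ S ∧ g ∉ S ∧ cls f = cls g) := by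
    intro f g
    rw [hA' f, hA' g, ← hcls]
    have hpS : ∀ h, h ∈ S → π h = ℓ₀ := fun h hh => if_pos hh
    have hpN : ∀ h, h ∉ S → π h = h := fun h hh => if_neg hh
    by_cases hf : f ∈ S <;> by_cases hg : g ∈ S
    · rw [hpS f hf, hpS g hg]
      exact ⟨fun _ => Or.inl ⟨Or.inl hf, Or.inl hg⟩, fun _ => rfl⟩
    · rw [hpS f hf, hpN g hg]
      constructor
      · intro h; exact Or.inl ⟨Or.inl hf, Or.inr h.symm⟩
      · rintro (⟨-, hg' | hg'⟩ | ⟨hf', -, -⟩)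
        · exact absurd hg' hg
        · exact hg'.symm
        · exact absurd hf hf'
    · rw [hpN f hf, hpS g hg]
      constructor
      · intro h; exact Or.inl ⟨Or.inr h, Or.inl hg⟩
      · rintro (⟨hf' | hf', -⟩ | ⟨-, hg', -⟩)
        · exact absurd hf' hf
        · exact hf'
        · exact absurd hg hg'
    · rw [hpN f hf, hpN g hg]
      constructor
      · intro h
        by_cases hfl : cls f = cls ℓ₀
        · exact Or.inl ⟨Or.inr hfl, Or.inr (h.symm.trans hfl)⟩
        · exact Or.inr ⟨hf, hg, h⟩
      · rintro (⟨hf' | hf', hg' | hg'⟩ | ⟨-, -, h⟩)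
        · exact absurd hf' hf
        · exact absurd hf' hf
        · exact absurd hg' hg
        · exact hf'.trans hg'.symm
        · exact h
  -- Tex for the recoloured texture
  have hTex' : Tex n G A' c' m := by
    refine ⟨hfin, hdisj, ?_, ?_, ?_⟩
    · intro f g hfg
      show 0 ≤ (if (f ∈ S ∨ cls f = cls ℓ₀) ∧ (g ∈ S ∨ cls g = cls ℓ₀) then 0 else c f g)
      split_ifs
      · exact le_rfl
      · exact hc0 f g hfg
    · intro f g hfg hncx
      have hne : ¬ (A' f '' Λ = A' g '' Λ) := fun h => hncx (hcoax _ _ h)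
      rw [hlat' f g] at hne
      have hP : ¬ ((f ∈ S ∨ cls f = cls ℓ₀) ∧ (g ∈ S ∨ cls g = cls ℓ₀)) := fun h => hne (Or.inl h)
      have hQ : ¬ (f ∉ S ∧ g ∉ S ∧ cls f = cls g) := fun h => hne (Or.inr h)
      have hcls_ne : cls f ≠ cls g := by
        intro h
        by_cases hf : f ∈ S
        · exact hP ⟨Or.inl hf, Or.inl (hS f g h hf)⟩
        · by_cases hg : g ∈ S
          · exact hf (hS g f h.symm hg)
          · exact hQ ⟨hf, hg, h⟩
      refine ⟨(hwall f g hcls_ne).1, ?_⟩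
      show 1 ≤ (if (f ∈ S ∨ cls f = cls ℓ₀) ∧ (g ∈ S ∨ cls g = cls ℓ₀) then 0 else c f g)
      rw [if_neg hP]
      exact (hwall f g hcls_ne).2
    · intro f g hfg hcx hne
      exfalso
      apply hne
      rw [hA' f, hA' g] at hcx ⊢
      by_cases hπfg : π f = π g
      · rw [hπfg]
      · exact hTF _ _ hπfg hcx
  have hTF' : TF n A' := by
    intro f g hfg hcx
    rw [hA' f, hA' g] at hcx ⊢
    by_cases hπfg : π f = π g
    · rw [hπfg]
    · exact hTF _ _ hπfg hcx
  refine ⟨hTex', hTF', ?_⟩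
  -- bodies
  have hDsc0 : Dsc 0 = Metric.closedBall (0 : E3) 1 := by
    show {y : E3 | ‖y‖ ≤ 1 ∧ ⟪y, (0 : E3)⟫_ℝ = 0} = Metric.closedBall 0 1
    ext y; simp [inner_zero_right]
  have hBc : IsCompact (Metric.closedBall (0 : E3) 1) := isCompact_closedBall 0 1
  have hBv : Convex ℝ (Metric.closedBall (0 : E3) 1) := convex_closedBall 0 1
  have hB0 : (0 : E3) ∈ Metric.closedBall (0 : E3) 1 := Metric.mem_closedBall_self zero_le_one
  have hDc : ∀ v : E3, IsCompact (Dsc v) := fun v =>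
    Metric.isCompact_of_isClosed_isBounded
      ((isClosed_le continuous_norm continuous_const).inter
        (isClosed_eq (continuous_id.inner continuous_const) continuous_const))
      (Metric.isBounded_closedBall.subset (cruxDisc_subset_closedBall v))
  have hWc : ∀ B : E3 ≃ₗᵢ[ℝ] E3, IsCompact (W B) := fun B => isCompact_cruxWulffBody B
  have hWv : ∀ B : E3 ≃ₗᵢ[ℝ] E3, Convex ℝ (W B) := fun B => convex_cruxWulffBody B
  have hW0 : ∀ B : E3 ≃ₗᵢ[ℝ] E3, (0 : E3) ∈ W B := fun B => zero_mem_cruxWulffBody B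
  have hWs : ∀ B : E3 ≃ₗᵢ[ℝ] E3, -W B = W B := fun B => neg_cruxWulffBody_eq B
  have hW3 : ∀ B : E3 ≃ₗᵢ[ℝ] E3, Metric.closedBall (0 : E3) (Real.sqrt 3) ⊆ W B := fun B =>
    closedBall_subset_cruxWulffBody B
  have hW5 : ∀ B : E3 ≃ₗᵢ[ℝ] E3, W B ⊆ Metric.closedBall (0 : E3) (Real.sqrt 5) := fun B =>
    cruxWulffBody_subset_closedBall B
  -- FREE ENERGY: body change on `S`
  have hFr : (∑ f, (Per (W (A' f)) (G f) - ∑ g, (if f = g then 0 else ι (W (A' f)) (G f) (G g)))) -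
      (Real.sqrt 5 - Real.sqrt 3) * (∑ f ∈ S, (Per (Metric.closedBall (0 : E3) 1) (G f) -
        ∑ g, (if f = g then 0 else ι (Metric.closedBall (0 : E3) 1) (G f) (G g)))) ≤
      ∑ f, (Per (W (A f)) (G f) - ∑ g, (if f = g then 0 else ι (W (A f)) (G f) (G g))) :=
    freeEnergy_bodyChange_ge G hPoly hvol hdisj (fun f => W (A f)) (fun f => hWc _) (fun f => hWv _)
      (fun f => hW0 _) (fun f => hWs _) (fun f => W (A' f)) (fun f => hWc _) (fun f => hWv _)
      (fun f => hW0 _) (fun f => hWs _) (Real.sqrt_pos.2 (by norm_num)) (Real.sqrt_pos.2 (by norm_num))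
      (fun f => hW3 _) (fun f => hW5 _) S (fun f hf => by
        show W (A' f) = W (A f)
        rw [hA' f]; simp [hπ, hf])
  -- WALLS: termwise
  have hterm : ∀ f g,
      (if f = g then 0 else c' f g / 2 * ι (Dsc (m f g)) (G f) (G g)) +
        (if f ≠ g ∧ (f ∈ S ∨ cls f = cls ℓ₀) ∧ (g ∈ S ∨ cls g = cls ℓ₀) ∧ cls f ≠ cls g
          then ι (Metric.closedBall (0 : E3) 1) (G f) (G g) / 2 else 0) ≤
      (if f = g then 0 else c f g / 2 * ι (Dsc (m f g)) (G f) (G g)) := by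
    intro f g
    by_cases hfg : f = g
    · simp [hfg]
    rw [if_neg hfg, if_neg hfg]
    have hιD : 0 ≤ ι (Dsc (m f g)) (G f) (G g) := by
      show 0 ≤ (per (Dsc (m f g)) (G f) + per (Dsc (m f g)) (G g) - per (Dsc (m f g)) (G f ∪ G g)) / 2
      exact div_nonneg (iota_nonneg_of_poly G hPoly hvol hdisj (hDc (m f g)) (convex_cruxDisc (m f g))
        (zero_mem_cruxDisc (m f g)) hfg) zero_le_two
    by_cases hgrp : (f ∈ S ∨ cls f = cls ℓ₀) ∧ (g ∈ S ∨ cls g = cls ℓ₀)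
    · have hc' : c' f g = 0 := by show (if _ then 0 else c f g) = 0; rw [if_pos hgrp]
      rw [hc', zero_div, zero_mul, zero_add]
      by_cases hne : cls f ≠ cls g
      · rw [if_pos ⟨hfg, hgrp.1, hgrp.2, hne⟩]
        obtain ⟨hm, hc1⟩ := hwall f g hne
        rw [hm, hDsc0]
        have hιB : 0 ≤ ι (Metric.closedBall (0 : E3) 1) (G f) (G g) := by
          show 0 ≤ (per (Metric.closedBall (0 : E3) 1) (G f) + per (Metric.closedBall (0 : E3) 1) (G g) -
            per (Metric.closedBall (0 : E3) 1) (G f ∪ G g)) / 2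
          exact div_nonneg (iota_nonneg_of_poly G hPoly hvol hdisj hBc hBv hB0 hfg) zero_le_two
        nlinarith
      · rw [if_neg (fun h => hne h.2.2.2)]
        exact mul_nonneg (div_nonneg (hc0 f g hfg) zero_le_two) hιD
    · have hc' : c' f g = c f g := by show (if _ then 0 else c f g) = c f g; rw [if_neg hgrp]
      rw [hc', if_neg (fun h => hgrp ⟨h.2.1, h.2.2.1⟩), add_zero]
  have hWl : (∑ f, ∑ g, (if f = g then 0 else c' f g / 2 * ι (Dsc (m f g)) (G f) (G g))) +
      (∑ f, ∑ g, (if f ≠ g ∧ (f ∈ S ∨ cls f = cls ℓ₀) ∧ (g ∈ S ∨ cls g = cls ℓ₀) ∧ cls f ≠ cls g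
          then ι (Metric.closedBall (0 : E3) 1) (G f) (G g) / 2 else 0)) ≤
      ∑ f, ∑ g, (if f = g then 0 else c f g / 2 * ι (Dsc (m f g)) (G f) (G g)) := by
    rw [← Finset.sum_add_distrib]
    refine Finset.sum_le_sum fun f _ => ?_
    rw [← Finset.sum_add_distrib]
    exact Finset.sum_le_sum fun g _ => hterm f g
  -- assemble
  have hEn : ∀ (B : Fin n → (E3 ≃ₗᵢ[ℝ] E3)) (cc : Fin n → Fin n → ℝ), En n G B cc m =
      (∑ f, (Per (W (B f)) (G f) - ∑ g, (if f = g then 0 else ι (W (B f)) (G f) (G g)))) +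
        ∑ f, ∑ g, (if f = g then 0 else cc f g / 2 * ι (Dsc (m f g)) (G f) (G g)) := by
    intro B cc
    show (∑ f, Per (W (B f)) (G f) -
        ∑ f, ∑ g, (if f = g then 0 else ι (W (B f)) (G f) (G g)) +
        ∑ f, ∑ g, (if f = g then 0 else cc f g / 2 * ι (Dsc (m f g)) (G f) (G g))) = _
    rw [Finset.sum_sub_distrib]
  rw [hEn A' c', hEn A c]
  linarith

end Summit.Ventures.Crystal3D.Cruxes.PolycrystalWulffBound.PolyDensity

end
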